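import Mathlib
import Summits.QuantumAdvantage.QuantumAdvantage.Theses.MobiusLadder
import Summits.QuantumAdvantage.QuantumAdvantage.Theorems.MobiusLadderDigitPolyUniformityAffineProducts
import Summits.QuantumAdvantage.QuantumAdvantage.Theorems.MobiusLadderWalshLiouvilleBound
import Literature.Computability.Complexity.BooleanFourier

/-!
# Crux `DigitPolyUniformity` (stmt-QuantumAdvantage-1392): `λ` is orthogonal to every `n^c`-SPARSE
# `𝔽₂`-polynomial phase of the digits, of any degree — unconditionally

Corollary of `digitPolyUniformity_affine_products` (`Theorems/…AffineProducts`: sums of `≤ n^c` products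
of affine forms): on the Boolean cube a monomial `x^s` equals the product of the affine forms `x_i`,
`i ∈ supp s` (bits are idempotent), so a polynomial with `≤ n^c` monomials is a sum of `≤ n^c` products of
affine forms. Hence for every `ε > 0`, eventually in `n`, every `P ∈ 𝔽₂[x_0..x_{n−1}]` with
`|supp P| ≤ n^c` has `|Σ_{N<2ⁿ} λ(N)(−1)^{P(bits N)}| ≤ ε2ⁿ` — whatever its degree and whichever digits
it uses (e.g. `x_0x_1⋯x_{n−1} + x_0x_{n−1} + x_{⌊n/2⌋}`).

Also recorded here, since every unconditional class of this crux so far is an instance of it: the general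
**Walsh `ℓ¹`-criterion** `liouville_corr_le_spectralNorm` — for EVERY real function `G` of the `n` digits,
`|Σ_{N<2ⁿ} λ(N) G(bits N)| ≤ ‖Ĝ‖₁ · 2^{n−n^c}` eventually (uniformly in `G`), straight from the PROVED route
item `WalshLiouvilleBound` and Fourier inversion on the cube. In particular any phase refuting the crux at
some large `n` must have Walsh spectral norm `‖Ĝ‖₁ > ε·2^{n^c}` (bent-type).
-/

set_option linter.dupNamespace false -- D-0017: single-problem summit ⇒ `QuantumAdvantage.QuantumAdvantage` by design

noncomputable section

namespace Summit.QuantumAdvantage.QuantumAdvantage.Theorems.MobiusLadder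

open Filter Finset
open Literature.Computability.Complexity.LowDegree (cubeFourierCoeff sum_cubeFourierCoeff_mul_walsh)
open Literature.Probability.RandomGraphs.LowDegree (walsh)

/-- **`λ` is orthogonal to every `n^c`-SPARSE polynomial phase, of any degree** (unconditional sub-class
of the crux): there is `c > 0` such that for every `ε > 0`, eventually in `n`, every
`P ∈ 𝔽₂[x_0..x_{n−1}]` with at most `n^c` monomials has `|Σ_{N<2ⁿ} λ(N)(−1)^{P(bits N)}| ≤ ε2ⁿ`. On the
cube a monomial `x^s` is the product of the affine forms `x_i`, `i ∈ supp s` (bits are idempotent), so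
`P` is a sum of `|supp P|` products of affine forms and `digitPolyUniformity_affine_products` applies.
[folklore] -/
theorem digitPolyUniformity_sparse : ∃ c : ℝ, 0 < c ∧ ∀ ε : ℝ, 0 < ε → ∀ᶠ n : ℕ in atTop,
    ∀ P : MvPolynomial (Fin n) (ZMod 2), (P.support.card : ℝ) ≤ (n : ℝ) ^ c →
      |∑ N ∈ range (2 ^ n), ((ArithmeticFunction.liouville N : ℤ) : ℝ) *
          (if MvPolynomial.eval (fun i : Fin n => if Nat.testBit N i then (1 : ZMod 2) else 0) P = 1
            then (-1 : ℝ) else 1)| ≤ ε * (2 : ℝ) ^ n := by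
  classical
  obtain ⟨c, hc, hmain⟩ := digitPolyUniformity_affine_products
  refine ⟨c, hc, fun ε hε => (hmain ε hε).mono fun n hn P hP => ?_⟩
  -- enumerate the support and write each monomial as a product of the affine forms `x_i` (or `1`)
  set h : ℕ := P.support.card with hh
  set σ : Fin h → (Fin n →₀ ℕ) := fun j => ((P.support.equivFin.symm j : P.support) : Fin n →₀ ℕ)
    with hσ
  set L : Fin h → Fin n → MvPolynomial (Fin n) (ZMod 2) := fun j i =>
    if i ∈ (σ j).support then MvPolynomial.X i else 1 with hLdef
  have hL : ∀ j i, (L j i).totalDegree ≤ 1 := by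
    intro j i
    simp only [hLdef]
    split_ifs
    · exact (MvPolynomial.totalDegree_X (R := ZMod 2) i).le
    · rw [MvPolynomial.totalDegree_one]; exact zero_le_one
  have key := hn h n 0 L hP (by rw [MvPolynomial.totalDegree_zero]; exact zero_le_one) hL
  -- pointwise: `P(pt) = (0 + Σ_j Π_i L j i)(pt)` at every `0/1` point
  have hpt : ∀ N : ℕ,
      MvPolynomial.eval (fun i : Fin n => if Nat.testBit N i then (1 : ZMod 2) else 0) P =
        MvPolynomial.eval (fun i : Fin n => if Nat.testBit N i then (1 : ZMod 2) else 0)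
          (0 + ∑ j, ∏ i, L j i) := by
    intro N
    set pt : Fin n → ZMod 2 := fun i => if Nat.testBit N i then (1 : ZMod 2) else 0 with hptdef
    -- right side: `Σ_j Π_{i ∈ supp (σ j)} pt i`
    have hR : MvPolynomial.eval pt (0 + ∑ j, ∏ i, L j i) = ∑ j, ∏ i ∈ (σ j).support, pt i := by
      rw [zero_add, map_sum]
      refine Finset.sum_congr rfl fun j _ => ?_
      rw [map_prod]
      have : ∀ i : Fin n, MvPolynomial.eval pt (L j i) = if i ∈ (σ j).support then pt i else 1 := by
        intro i
        simp only [hLdef]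
        split_ifs
        · exact MvPolynomial.eval_X _
        · exact map_one _
      rw [Finset.prod_congr rfl fun i _ => this i, Finset.prod_ite_mem, Finset.univ_inter]
    -- left side: `Σ_{s ∈ supp P} Π_{i ∈ supp s} pt i`
    have hLft : MvPolynomial.eval pt P = ∑ s ∈ P.support, ∏ i ∈ s.support, pt i := by
      conv_lhs => rw [P.as_sum]
      rw [map_sum]
      refine Finset.sum_congr rfl fun s hs => ?_
      rw [MvPolynomial.eval_monomial, Finsupp.prod]
      have hcoeff : P.coeff s = 1 := by
        have hne : P.coeff s ≠ 0 := MvPolynomial.mem_support_iff.1 hs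
        have h2 : ∀ x : ZMod 2, x = 0 ∨ x = 1 := by decide
        rcases h2 (P.coeff s) with h0 | h1
        · exact absurd h0 hne
        · exact h1
      rw [hcoeff, one_mul]
      refine Finset.prod_congr rfl fun i hi => ?_
      simp only [hptdef]
      exact Summit.QuantumAdvantage.DigitPolyUniformity.SketchLAR.EvalMemLowDeg.boolBit_pow
        (Nat.testBit N i) (Finsupp.mem_support_iff.1 hi)
    rw [hR, hLft]
    -- reindex the support by `Fin h`
    have hre : ∑ j : Fin h, ∏ i ∈ (σ j).support, pt i =
        ∑ x : P.support, ∏ i ∈ (x : Fin n →₀ ℕ).support, pt i := by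
      simp only [hσ]
      exact Equiv.sum_comp P.support.equivFin.symm (fun x : P.support => ∏ i ∈ (x : Fin n →₀ ℕ).support, pt i)
    rw [hre]
    exact (Finset.sum_coe_sort P.support (fun s : Fin n →₀ ℕ => ∏ i ∈ s.support, pt i)).symm
  rw [Finset.sum_congr rfl fun N _ => by rw [hpt N]]
  exact key

/-- **The Walsh `ℓ¹`-criterion** (uniform in the test function): there is `c > 0` such that eventually in
`n`, for EVERY `G : {0,1}ⁿ → ℝ`, `|Σ_{N<2ⁿ} λ(N)·G(bits N)| ≤ (Σ_S |Ĝ(S)|) · 2^{n − n^c}` — Fourier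
inversion `G = Σ_S Ĝ(S) χ_S` and Bourgain's bound for each character (the PROVED route item
`WalshLiouvilleBound`). [folklore] -/
theorem liouville_corr_le_spectralNorm : ∃ c : ℝ, 0 < c ∧ ∀ᶠ n : ℕ in atTop,
    ∀ G : (Fin n → Bool) → ℝ,
      |∑ N ∈ range (2 ^ n), ((ArithmeticFunction.liouville N : ℤ) : ℝ) * G (fun i : Fin n => Nat.testBit N i)| ≤
        (∑ S : Finset (Fin n), |cubeFourierCoeff G S|) * (2 : ℝ) ^ ((n : ℝ) - (n : ℝ) ^ c) := by
  obtain ⟨c, hc, hwalsh⟩ := walshLiouvilleBound_proof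
  refine ⟨c, hc, hwalsh.mono fun n hn G => ?_⟩
  -- expand `G(bits N)` in the Walsh basis and exchange the sums
  have hexp : ∑ N ∈ range (2 ^ n), ((ArithmeticFunction.liouville N : ℤ) : ℝ) * G (fun i : Fin n => Nat.testBit N i) =
      ∑ S : Finset (Fin n), cubeFourierCoeff G S *
        ∑ N ∈ range (2 ^ n), ((ArithmeticFunction.liouville N : ℤ) : ℝ) * walsh S (fun i : Fin n => Nat.testBit N i) := by
    calc ∑ N ∈ range (2 ^ n), ((ArithmeticFunction.liouville N : ℤ) : ℝ) * G (fun i : Fin n => Nat.testBit N i)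
        = ∑ N ∈ range (2 ^ n), ∑ S : Finset (Fin n), cubeFourierCoeff G S *
            (((ArithmeticFunction.liouville N : ℤ) : ℝ) * walsh S (fun i : Fin n => Nat.testBit N i)) := by
          refine Finset.sum_congr rfl fun N _ => ?_
          rw [← sum_cubeFourierCoeff_mul_walsh G (fun i : Fin n => Nat.testBit N i), Finset.mul_sum]
          exact Finset.sum_congr rfl fun S _ => by ring
      _ = ∑ S : Finset (Fin n), ∑ N ∈ range (2 ^ n), cubeFourierCoeff G S *
            (((ArithmeticFunction.liouville N : ℤ) : ℝ) * walsh S (fun i : Fin n => Nat.testBit N i)) :=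
          Finset.sum_comm
      _ = _ := Finset.sum_congr rfl fun S _ => by rw [Finset.mul_sum]
  rw [hexp]
  refine (Finset.abs_sum_le_sum_abs _ _).trans ?_
  rw [Finset.sum_mul]
  refine Finset.sum_le_sum fun S _ => ?_
  rw [abs_mul]
  exact mul_le_mul_of_nonneg_left (hn S) (abs_nonneg _)

end Summit.QuantumAdvantage.QuantumAdvantage.Theorems.MobiusLadder

end
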